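import Literature.Geometry.GaugeTheory.SpincStructureCovDerivPairingForm
import HarnessLib

/-!
# The 1-form `Re⟨φ, γ(·)ψ⟩` and the pointwise adjointness identity for the Dirac operator:
# `div Re⟨φ, γ(·)ψ⟩ = Re⟨φ, D_Aψ⟩ - Re⟨D_Aφ, ψ⟩`

Topic `Literature/Geometry/GaugeTheory`; the pointwise identity whose integral is the formal
self-adjointness `∫⟨φ, D_Aψ⟩ = ∫⟨D_Aφ, ψ⟩` of the `Spin^c` Dirac operator on a closed manifold
(Lawson–Michelsohn II.5.3; in Taubes 1994, §3 the integration by parts turning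
`∫⟨D_AD_Aβ, β⟩` into `∫|D_Aβ|²` in (21)).  For a unitary connection `A` on `det P̃` and smooth spinor
fields `ψ`, `φ` of a `Spin^c` structure `𝔰`:

* `cliffordPairingForm ψ φ` — the real 1-form `v ↦ Re⟨φ, γ(v)ψ⟩` (`γ(v) = Σ_k g(v, e_k)γ_k` the
  Clifford multiplication, `cliffordFrame`; well defined by `G_ij γ^{(j)}(v) G_ijᴴ = γ^{(i)}(v)`,
  `transition_cover`), smooth (`smoothAt_cliffordPairingForm`);
* **`sum_covDerivForm_cliffordPairingForm_eq`** — in the frame of a chart `U_i ∋ x`,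
  `Σ_k (e_k(θ(e_k)) - θ(∇_{e_k}e_k)) = Re⟨φ, D_Aψ⟩ - Re⟨D_Aφ, ψ⟩` for `θ = Re⟨φ, γ(·)ψ⟩`:
  the Leibniz rule for the pairing, `∇̃_v(γ_kψ) = γ_k∇̃_vψ + [a(v), γ_k]ψ` with
  `[dρ(ω̃(v)), γ_k] = Σ_l ω̃_{l,k}(v)γ_l` (Morgan's Lemma 3.2.4, `spinRepDeriv_mul_cliffordBasis_sub`)
  cancelling `θ(∇_{e_k}e_k) = Σ_l ω̃_{l,k}(e_k) Re⟨φ, γ_lψ⟩`, and `γ_kᴴ = -γ_k`.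

PROVED, 0 named facts.

## References

* J. W. Morgan, *The Seiberg–Witten Equations and Applications to the Topology of Smooth
  Four-Manifolds* (1996), §3.1, Lemma 3.2.4, §3.3 (3.3). [MorganSWBook1996]
* C. H. Taubes, *The Seiberg–Witten invariants and symplectic forms*, Math. Res. Lett. 1 (1994)
  809–822, §3 (21). [Taubes1994]
-/

noncomputable section

open scoped Manifold ContDiff Topology Bundle ComplexConjugate Matrix
open Set Function Filter Bundle Complex
open Literature.Geometry.Lorentzian (PseudoRiemannianMetric contMDiffAt_clm_apply_iff)
open Literature.Topology.FourManifolds (SmoothOrientation)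

namespace Literature.Geometry.GaugeTheory

/-- **The Clifford matrices are skew-Hermitian**: `γ_kᴴ = -γ_k`. [cite: MorganSWBook1996, §2.1] -/
theorem conjTranspose_cliffordBasis (k : Fin 4) : (cliffordBasis k)ᴴ = -cliffordBasis k := by
  rw [cliffordBasis, cliffordGamma_conjTranspose]

/-- `⟨u, γ_k w⟩ = -⟨γ_k u, w⟩` (`γ_k` skew-Hermitian). [cite: MorganSWBook1996, §2.1] -/
theorem star_dotProduct_cliffordBasis_mulVec (k : Fin 4) (u w : Spinor → ℂ) :
    star u ⬝ᵥ (cliffordBasis k *ᵥ w) = -(star (cliffordBasis k *ᵥ u) ⬝ᵥ w) := by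
  rw [Matrix.star_mulVec, conjTranspose_cliffordBasis, Matrix.vecMul_neg, neg_dotProduct, neg_neg,
    Matrix.dotProduct_mulVec]

namespace SpincStructure

variable {X : Type*} [TopologicalSpace X] [ChartedSpace (EuclideanSpace ℝ (Fin 4)) X] [IsManifold (𝓡 4) ∞ X]
  {g : PseudoRiemannianMetric (𝓡 4) ∞ (EuclideanSpace ℝ (Fin 4)) (TangentSpace (𝓡 4) : X → Type _)}
  {o : SmoothOrientation (𝓡 4) X} {ι : Type*} (𝔰 : SpincStructure g o ι)

/-! ### The pairing `Re⟨φ_i, γ(v)ψ_i⟩` and its chart independence -/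

/-- **`⟨φ_j, γ^{(j)}(v)ψ_j⟩ = ⟨φ_i, γ^{(i)}(v)ψ_i⟩` on `U_i ∩ U_j`** (`φ_i = G_ijφ_j`, `ψ_i = G_ijψ_j`,
`γ^{(i)}(v) = G_ij γ^{(j)}(v) G_ijᴴ`, `G_ij` unitary). [cite: MorganSWBook1996, §3.1] -/
theorem star_dotProduct_cliffordFrame_mulVec_eq_of_mem_overlap (ψ φ : SpinorField 𝔰) (i j : ι) {x : X}
    (hx : x ∈ 𝔰.baseSet i ∩ 𝔰.baseSet j) (v : TangentSpace (𝓡 4) x) :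
    star (φ.toFun j x) ⬝ᵥ (cliffordFrame g x (fun k ↦ 𝔰.frame j k x) v *ᵥ ψ.toFun j x) =
      star (φ.toFun i x) ⬝ᵥ (cliffordFrame g x (fun k ↦ 𝔰.frame i k x) v *ᵥ ψ.toFun i x) := by
  have hG := 𝔰.conjTranspose_transition_mul_self i j hx.1 hx.2
  rw [← 𝔰.transition_cover i j x hx v, ← φ.mulVec_toFun i j x hx, ← ψ.mulVec_toFun i j x hx, Matrix.star_mulVec,
    ← Matrix.dotProduct_mulVec, Matrix.mulVec_mulVec, Matrix.mulVec_mulVec, ← Matrix.mul_assoc, ← Matrix.mul_assoc, hG,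
    Matrix.one_mul, Matrix.mul_assoc, hG, Matrix.mul_one]

/-- `γ(v)` is the coordinate combination `Σ_k g(v, e_k)γ_k` acting on a spinor, paired. [cite: MorganSWBook1996, §3.1] -/
theorem star_dotProduct_cliffordFrame_mulVec_eq_sum (ψ φ : Spinor → ℂ) (x : X) (e : Fin 4 → TangentSpace (𝓡 4) x)
    (v : TangentSpace (𝓡 4) x) :
    star φ ⬝ᵥ (cliffordFrame g x e v *ᵥ ψ) = ∑ k, ((g.val x v (e k) : ℝ) : ℂ) * (star φ ⬝ᵥ (cliffordBasis k *ᵥ ψ)) := by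
  rw [cliffordFrame_eq_sum, Matrix.sum_mulVec, dotProduct_sum]
  refine Finset.sum_congr rfl fun k _ ↦ ?_
  rw [Matrix.smul_mulVec, dotProduct_smul, smul_eq_mul]

/-- **The real-linear map `v ↦ Re⟨φ_i(x), γ(v)ψ_i(x)⟩`** on `T_x X`. [cite: MorganSWBook1996, §3.1] -/
def cliffordPairingLin (ψ φ : SpinorField 𝔰) (i : ι) (x : X) : TangentSpace (𝓡 4) x →ₗ[ℝ] ℝ where
  toFun v := (star (φ.toFun i x) ⬝ᵥ (cliffordFrame g x (fun k ↦ 𝔰.frame i k x) v *ᵥ ψ.toFun i x)).re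
  map_add' v w := by
    simp only [star_dotProduct_cliffordFrame_mulVec_eq_sum, map_add, _root_.add_apply, Complex.ofReal_add,
      add_mul, Finset.sum_add_distrib, Complex.add_re]
  map_smul' c v := by
    simp only [star_dotProduct_cliffordFrame_mulVec_eq_sum, map_smul, FunLike.coe_smul, Pi.smul_apply,
      smul_eq_mul, Complex.ofReal_mul, mul_assoc, ← Finset.mul_sum, Complex.re_ofReal_mul, RingHom.id_apply]

/-- **The real 1-form `Re⟨φ, γ(·)ψ⟩`** of two spinor fields (read in the chart chosen at each point;
chart-independent by `star_dotProduct_cliffordFrame_mulVec_eq_of_mem_overlap`). [cite: MorganSWBook1996, §3.1] -/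
def cliffordPairingForm (ψ φ : SpinorField 𝔰) : RealOneForm X := fun x ↦
  haveI : T2Space (TangentSpace (𝓡 4) x) := inferInstanceAs (T2Space (EuclideanSpace ℝ (Fin 4)))
  haveI : IsTopologicalAddGroup (TangentSpace (𝓡 4) x) := inferInstanceAs (IsTopologicalAddGroup (EuclideanSpace ℝ (Fin 4)))
  haveI : ContinuousSMul ℝ (TangentSpace (𝓡 4) x) := inferInstanceAs (ContinuousSMul ℝ (EuclideanSpace ℝ (Fin 4)))
  haveI : FiniteDimensional ℝ (TangentSpace (𝓡 4) x) := inferInstanceAs (FiniteDimensional ℝ (EuclideanSpace ℝ (Fin 4)))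
  LinearMap.toContinuousLinearMap (𝔰.cliffordPairingLin ψ φ (𝔰.indexAt x) x)

/-- Unfolding `cliffordPairingForm` (chart `indexAt x`). [folklore] -/
theorem cliffordPairingForm_apply (ψ φ : SpinorField 𝔰) (x : X) (v : TangentSpace (𝓡 4) x) :
    𝔰.cliffordPairingForm ψ φ x v =
      (star (φ.toFun (𝔰.indexAt x) x) ⬝ᵥ (cliffordFrame g x (fun k ↦ 𝔰.frame (𝔰.indexAt x) k x) v *ᵥ ψ.toFun (𝔰.indexAt x) x)).re :=
  rfl

/-- In any chart containing `x`: `Re⟨φ, γ(v)ψ⟩_x = Re⟨φ_i(x), γ^{(i)}(v)ψ_i(x)⟩`. [cite: MorganSWBook1996, §3.1] -/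
theorem cliffordPairingForm_apply_of_mem (ψ φ : SpinorField 𝔰) {i : ι} {x : X} (hx : x ∈ 𝔰.baseSet i)
    (v : TangentSpace (𝓡 4) x) :
    𝔰.cliffordPairingForm ψ φ x v = (star (φ.toFun i x) ⬝ᵥ (cliffordFrame g x (fun k ↦ 𝔰.frame i k x) v *ᵥ ψ.toFun i x)).re := by
  rw [cliffordPairingForm_apply, 𝔰.star_dotProduct_cliffordFrame_mulVec_eq_of_mem_overlap ψ φ i (𝔰.indexAt x)
    ⟨hx, 𝔰.mem_baseSet_indexAt x⟩ v]

/-- On the frame: `Re⟨φ, γ(e_k)ψ⟩ = Re⟨φ_i, γ_kψ_i⟩` near a point of `U_i`. [cite: MorganSWBook1996, §3.1] -/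
theorem cliffordPairingForm_frame_eventuallyEq (ψ φ : SpinorField 𝔰) (i : ι) (k : Fin 4) {x : X} (hx : x ∈ 𝔰.baseSet i) :
    (fun y ↦ 𝔰.cliffordPairingForm ψ φ y (𝔰.frame i k y)) =ᶠ[𝓝 x]
      fun y ↦ (star (φ.toFun i y) ⬝ᵥ (cliffordBasis k *ᵥ ψ.toFun i y)).re := by
  filter_upwards [(𝔰.isOpen_baseSet i).mem_nhds hx] with y hy
  rw [𝔰.cliffordPairingForm_apply_of_mem ψ φ hy, cliffordFrame_frame g (𝔰.isOrthonormalFrame_frame i hy) k]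

/-! ### Smoothness -/

/-- **`y ↦ Re⟨φ_i, γ^{(i)}(W)ψ_i⟩(y)` is smooth** at the points of the chart, for smooth spinor fields and a
field `W` smooth at the point. [cite: MorganSWBook1996, §3.1] -/
theorem contMDiffAt_re_star_dotProduct_cliffordFrame {ψ φ : SpinorField 𝔰} (hψ : ψ.IsSmooth) (hφ : φ.IsSmooth)
    (i : ι) {x : X} (hx : x ∈ 𝔰.baseSet i) {W : Π y : X, TangentSpace (𝓡 4) y}
    (hW : ContMDiffAt (𝓡 4) ((𝓡 4).prod 𝓘(ℝ, EuclideanSpace ℝ (Fin 4))) ∞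
      (fun y : X ↦ TotalSpace.mk' (EuclideanSpace ℝ (Fin 4)) (E := (TangentSpace (𝓡 4) : X → Type _)) y (W y)) x) :
    ContMDiffAt (𝓡 4) 𝓘(ℝ, ℝ) ∞
      (fun y ↦ (star (φ.toFun i y) ⬝ᵥ (cliffordFrame g y (fun k ↦ 𝔰.frame i k y) (W y) *ᵥ ψ.toFun i y)).re) x := by
  have hnhds := (𝔰.isOpen_baseSet i).mem_nhds hx
  have ht : ∀ a, ContMDiffAt (𝓡 4) 𝓘(ℝ, ℂ) ∞ (fun y ↦ conj (φ.toFun i y a)) x := fun a ↦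
    Complex.conjCLE.contDiff.comp_contMDiffAt ((hφ i a).contMDiffAt hnhds)
  have hs : ∀ b, ContMDiffAt (𝓡 4) 𝓘(ℝ, ℂ) ∞ (fun y ↦ ψ.toFun i y b) x := fun b ↦ (hψ i b).contMDiffAt hnhds
  have hg : ∀ k, ContMDiffAt (𝓡 4) 𝓘(ℝ, ℂ) ∞ (fun y ↦ ((g.val y (W y) (𝔰.frame i k y) : ℝ) : ℂ)) x := fun k ↦
    Complex.ofRealCLM.contDiff.comp_contMDiffAt (g.contMDiffAt_val_apply le_rfl hW (𝔰.contMDiffAt_frame i k hx))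
  have heq : (fun y ↦ (star (φ.toFun i y) ⬝ᵥ (cliffordFrame g y (fun k ↦ 𝔰.frame i k y) (W y) *ᵥ ψ.toFun i y)).re) =
      fun y ↦ (∑ k, ((g.val y (W y) (𝔰.frame i k y) : ℝ) : ℂ) *
        ∑ a, conj (φ.toFun i y a) * ∑ b, cliffordBasis k a b * ψ.toFun i y b).re := by
    funext y
    rw [star_dotProduct_cliffordFrame_mulVec_eq_sum]
    rfl
  rw [heq]
  have h2 : ContMDiffAt (𝓡 4) 𝓘(ℝ, ℂ) ∞ (fun y ↦ ∑ k, ((g.val y (W y) (𝔰.frame i k y) : ℝ) : ℂ) *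
      ∑ a, conj (φ.toFun i y a) * ∑ b, cliffordBasis k a b * ψ.toFun i y b) x :=
    ContMDiffAt.sum fun k _ ↦ ContMDiffAt.mul_complex (hg k) (ContMDiffAt.sum fun a _ ↦ ContMDiffAt.mul_complex (ht a)
      (ContMDiffAt.sum fun b _ ↦ ContMDiffAt.mul_complex contMDiffAt_const (hs b)))
  exact Complex.reCLM.contDiff.comp_contMDiffAt h2

/-- **The covector field `w ↦ Re⟨φ, γ(e.symmL w)ψ⟩` is smooth at `x₀`.** [cite: MorganSWBook1996, §3.1] -/
theorem contMDiffAt_cliffordPairingForm_comp_symmL {ψ φ : SpinorField 𝔰} (hψ : ψ.IsSmooth) (hφ : φ.IsSmooth) (x₀ : X) :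
    ContMDiffAt (𝓡 4) 𝓘(ℝ, EuclideanSpace ℝ (Fin 4) →L[ℝ] ℝ) ∞ (fun x ↦ (𝔰.cliffordPairingForm ψ φ x).comp
      ((trivializationAt (EuclideanSpace ℝ (Fin 4)) (TangentSpace (𝓡 4) : X → Type _) x₀).symmL ℝ x)) x₀ := by
  rw [contMDiffAt_clm_apply_iff]
  intro w
  have hi := 𝔰.mem_baseSet_indexAt x₀
  have h := 𝔰.contMDiffAt_re_star_dotProduct_cliffordFrame hψ hφ (𝔰.indexAt x₀) hi (contMDiffAt_symmL_trivializationAt x₀ w)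
  refine h.congr_of_eventuallyEq ?_
  filter_upwards [(𝔰.isOpen_baseSet (𝔰.indexAt x₀)).mem_nhds hi] with x hx
  exact 𝔰.cliffordPairingForm_apply_of_mem ψ φ hx _

/-- **`Re⟨φ, γ(·)ψ⟩` is a smooth 1-form** for smooth spinor fields. [cite: MorganSWBook1996, §3.1] -/
theorem smoothAt_cliffordPairingForm {ψ φ : SpinorField 𝔰} (hψ : ψ.IsSmooth) (hφ : φ.IsSmooth) (x₀ : X) :
    (𝔰.cliffordPairingForm ψ φ).SmoothAt x₀ := by
  obtain ⟨F, hF⟩ : ∃ F : X → EuclideanSpace ℝ (Fin 4) →L[ℝ] ℝ, F = fun x ↦ (𝔰.cliffordPairingForm ψ φ x).comp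
      ((trivializationAt (EuclideanSpace ℝ (Fin 4)) (TangentSpace (𝓡 4) : X → Type _) x₀).symmL ℝ x) := ⟨_, rfl⟩
  have hFs : ContMDiffAt (𝓡 4) 𝓘(ℝ, EuclideanSpace ℝ (Fin 4) →L[ℝ] ℝ) ∞ F x₀ :=
    hF ▸ 𝔰.contMDiffAt_cliffordPairingForm_comp_symmL hψ hφ x₀
  have hG : ContMDiffAt (𝓡 4) 𝓘(ℝ, (EuclideanSpace ℝ (Fin 4)) [⋀^Fin 1]→L[ℝ] ℝ) ∞
      ((fun L : EuclideanSpace ℝ (Fin 4) →L[ℝ] ℝ ↦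
        ContinuousAlternatingMap.ofSubsingleton ℝ (EuclideanSpace ℝ (Fin 4)) ℝ (0 : Fin 1) L) ∘ F) x₀ :=
    (ContinuousAlternatingMap.ofSubsingletonLIE (𝕜 := ℝ) (E := EuclideanSpace ℝ (Fin 4)) (F := ℝ)
      (0 : Fin 1)).toContinuousLinearEquiv.contDiff.comp_contMDiffAt hFs
  have hG' : ContDiffWithinAt ℝ ∞
      (((fun L : EuclideanSpace ℝ (Fin 4) →L[ℝ] ℝ ↦
        ContinuousAlternatingMap.ofSubsingleton ℝ (EuclideanSpace ℝ (Fin 4)) ℝ (0 : Fin 1) L) ∘ F) ∘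
        (extChartAt (𝓡 4) x₀).symm) (range (𝓡 4)) (extChartAt (𝓡 4) x₀ x₀) := by
    simpa using (contMDiffAt_iff.1 hG).2
  have hev : ∀ y ∈ (extChartAt (𝓡 4) x₀).target, (𝔰.cliffordPairingForm ψ φ).toMForm.inChart x₀ y =
      ContinuousAlternatingMap.ofSubsingleton ℝ (EuclideanSpace ℝ (Fin 4)) ℝ (0 : Fin 1) (F ((extChartAt (𝓡 4) x₀).symm y)) := by
    intro y hy
    have hx : (extChartAt (𝓡 4) x₀).symm y ∈ (chartAt (EuclideanSpace ℝ (Fin 4)) x₀).source := by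
      rw [← extChartAt_source (𝓡 4)]
      exact (extChartAt (𝓡 4) x₀).map_target hy
    have hD : mfderivWithin 𝓘(ℝ, EuclideanSpace ℝ (Fin 4)) (𝓡 4) (extChartAt (𝓡 4) x₀).symm (range (𝓡 4)) y =
        (trivializationAt (EuclideanSpace ℝ (Fin 4)) (TangentSpace (𝓡 4) : X → Type _) x₀).symmL ℝ
          ((extChartAt (𝓡 4) x₀).symm y) := by
      rw [TangentBundle.symmL_trivializationAt hx, (extChartAt (𝓡 4) x₀).right_inv hy]
    ext v
    rw [Literature.Geometry.Kaehler.MForm.inChart_apply, hD, ContinuousAlternatingMap.ofSubsingleton_apply_apply]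
    simp only [hF, RealOneForm.toMForm_apply, ContinuousLinearMap.comp_apply]
    rfl
  unfold RealOneForm.SmoothAt
  refine hG'.congr_of_eventuallyEq ?_ (hev _ (mem_extChartAt_target x₀))
  filter_upwards [extChartAt_target_mem_nhdsWithin x₀] with y hy using hev y hy

/-! ### The adjointness identity -/

variable [g.HasLeviCivita]

/-- **`∇̃_v(γ_k s) = γ_k ∇̃_v s + [a_i(v), γ_k] s`** for a constant Clifford matrix and a local spinor
differentiable at `x` (`d(γ_k s) = γ_k ds`). [cite: MorganSWBook1996, §3.2 (3.2)] -/
theorem localCovDeriv_cliffordBasis_mulVec (A : 𝔰.detLineBundle.Connection) (i : ι) (k : Fin 4) {s : X → Spinor → ℂ}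
    {x : X} (hs : SpinorMDiffAt s x) (v : TangentSpace (𝓡 4) x) :
    𝔰.localCovDeriv A i (fun y ↦ cliffordBasis k *ᵥ s y) x v =
      cliffordBasis k *ᵥ 𝔰.localCovDeriv A i s x v +
        (𝔰.connMatrix A i x v * cliffordBasis k - cliffordBasis k * 𝔰.connMatrix A i x v) *ᵥ s x := by
  rw [localCovDeriv, localCovDeriv, spinorDeriv_mulVec (matMDiffAt_const _ x) hs, matDeriv_const, Matrix.zero_mulVec,
    zero_add, Matrix.mulVec_add, Matrix.sub_mulVec, Matrix.mulVec_mulVec, Matrix.mulVec_mulVec]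
  abel

/-- **The pointwise adjointness identity for the Dirac operator** in the frame of a chart `U_i ∋ x`,
for smooth spinor fields `ψ`, `φ` and the 1-form `θ = Re⟨φ, γ(·)ψ⟩`:
`Σ_k (e_k(θ(e_k)) - θ(∇_{e_k}e_k)) = Re⟨φ, D_Aψ⟩ - Re⟨D_Aφ, ψ⟩` (`D_A = Σ_k γ_k∇̃_{e_k}`, (3.3)).
[cite: MorganSWBook1996, §3.3 (3.3), Lemma 3.2.4] -/
theorem sum_covDerivForm_cliffordPairingForm_eq (A : 𝔰.detLineBundle.Connection) {ψ φ : SpinorField 𝔰}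
    (hψ : ψ.IsSmooth) (hφ : φ.IsSmooth) (i : ι) {x : X} (hx : x ∈ 𝔰.baseSet i) :
    ∑ k, (mvfderiv (𝓡 4) (fun y ↦ 𝔰.cliffordPairingForm ψ φ y (𝔰.frame i k y)) x (𝔰.frame i k x) -
        𝔰.cliffordPairingForm ψ φ x (g.leviCivita (𝔰.frame i k) x (𝔰.frame i k x))) =
      (star (φ.toFun i x) ⬝ᵥ dirac A ψ i x).re - (star (dirac A φ i x) ⬝ᵥ ψ.toFun i x).re := by
  have hnhds := (𝔰.isOpen_baseSet i).mem_nhds hx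
  have hψd : SpinorMDiffAt (ψ.toFun i) x := hψ.spinorMDiffAt hx
  have hφd : SpinorMDiffAt (φ.toFun i) x := hφ.spinorMDiffAt hx
  have hγψ : ∀ k, SpinorMDiffAt (fun y ↦ cliffordBasis k *ᵥ ψ.toFun i y) x := fun k ↦
    SpinorMDiffAt.mulVec (matMDiffAt_const _ x) hψd
  -- the derivative term
  have hD : ∀ k, mvfderiv (𝓡 4) (fun y ↦ 𝔰.cliffordPairingForm ψ φ y (𝔰.frame i k y)) x (𝔰.frame i k x) =
      (star (𝔰.localCovDeriv A i (φ.toFun i) x (𝔰.frame i k x)) ⬝ᵥ (cliffordBasis k *ᵥ ψ.toFun i x)).re +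
        ((star (φ.toFun i x) ⬝ᵥ (cliffordBasis k *ᵥ 𝔰.localCovDeriv A i (ψ.toFun i) x (𝔰.frame i k x))).re +
          (star (φ.toFun i x) ⬝ᵥ ((∑ l, ((𝔰.lcForm i x (𝔰.frame i k x) l k : ℝ) : ℂ) • cliffordBasis l) *ᵥ ψ.toFun i x)).re) := by
    intro k
    rw [Literature.Geometry.Lorentzian.mvfderiv_congr_nhds (𝔰.cliffordPairingForm_frame_eventuallyEq ψ φ i k hx),
      mvfderiv_re_eq (mdifferentiableAt_star_dotProduct (hγψ k) hφd), 𝔰.complexDeriv_spinorPairing_eq A i (hγψ k) hφd,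
      𝔰.localCovDeriv_cliffordBasis_mulVec A i k hψd, 𝔰.connMatrix_mul_cliffordBasis_sub A hx, Complex.add_re,
      dotProduct_add, Complex.add_re]
  -- the connection term
  have hC : ∀ k, 𝔰.cliffordPairingForm ψ φ x (g.leviCivita (𝔰.frame i k) x (𝔰.frame i k x)) =
      (star (φ.toFun i x) ⬝ᵥ ((∑ l, ((𝔰.lcForm i x (𝔰.frame i k x) l k : ℝ) : ℂ) • cliffordBasis l) *ᵥ ψ.toFun i x)).re := by
    intro k
    rw [𝔰.cliffordPairingForm_apply_of_mem ψ φ hx, cliffordFrame_eq_sum]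
    rfl
  -- `⟨∇̃_kφ, γ_kψ⟩ = -⟨γ_k∇̃_kφ, ψ⟩`
  have hskew : ∀ k, (star (𝔰.localCovDeriv A i (φ.toFun i) x (𝔰.frame i k x)) ⬝ᵥ (cliffordBasis k *ᵥ ψ.toFun i x)).re =
      -(star (cliffordBasis k *ᵥ covDeriv A φ i x (𝔰.frame i k x)) ⬝ᵥ ψ.toFun i x).re := fun k ↦ by
    rw [star_dotProduct_cliffordBasis_mulVec, Complex.neg_re, 𝔰.covDeriv_eq_localCovDeriv]
  simp only [hD, hC, hskew, dirac, dotProduct_sum, star_sum, sum_dotProduct, Complex.re_sum, Finset.sum_sub_distrib,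
    Finset.sum_add_distrib, Finset.sum_neg_distrib, 𝔰.covDeriv_eq_localCovDeriv]
  ring

end SpincStructure

end Literature.Geometry.GaugeTheory

end
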